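import Summits.CriticalPhenomena.PercolationContinuityZ3.Theorems.PercNearOneGluingNoHeavyLowerTailCertRowsV
import Summits.CriticalPhenomena.PercolationContinuityZ3.Theorems.PercNearOneGluingNoHeavyLowerTailThresholdSunflower
import HarnessLib

/-!
# `NoHeavyLowerTail` (stmt-CriticalPhenomena-4575) — certificate machine, part 10:
# strong-Harris threshold rows (Gladkov's strong FKG inequality for three increasing events) as data

Support file (depth prover nh-dp-blobmono, respawn g3; `--supports stmt-CriticalPhenomena-4575`).  Computable definitions +
soundness; no named facts, no sorries, standard axioms.

Parts 8–9 added Harris and van den Berg–Kahn rows.  The route-B degree-4 LPs of this generation (kit j051997/j051998: rows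
`ts/kn` of the `7/6` certificate + all Harris + `cap` rows) are INFEASIBLE at the sharp constant `1` for the three-relay event
gluing `EG3`, so the next vocabulary is Gladkov's strong Harris–Kleitman inequality for three increasing events `U₁, U₂, U₃`
(Bull. LMS 2024, Thm 2.1; tree `ThresholdSunflower.prodBernoulli_threshold_one_of_three` / `…_two_of_three`, whose special
case is the Aas–Gladkov three-point row `prodBernoulli_threePoint_strongHarris`).  The printed inequalities are sums of three
products; the certificate machine (`CertCheck.Row`) takes binomial rows `μE₁ μE₂ ≤ μE₃ μE₄`, so this file records the binomial
WEAKENINGS (drop one of the three products; the remaining two combine because the cells are disjoint):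

* `RowSpecS.one U₁ U₂ U₃` — threshold `m = 1`: `μ(O₁) · μ(O₂ ∪ O₃) ≤ μ(A₂) · μ(N)` with `O_i = {only U_i}`, `A₂ = {at least two}`,
  `N = {none}`;
* `RowSpecS.two U₁ U₂ U₃` — threshold `m = 2`: `μ(E₁₂) · μ(E₁₃ ∪ E₂₃) ≤ μ(T) · μ(L)` with `E_ij = {exactly U_i, U_j}`,
  `T = {all three}`, `L = {at most one}`;
  (`U₁ U₂ U₃ : Formula`, POSITIVE DNF formulas = increasing events; the index to single out is put first by the generator);
* events are read off the connection pattern through Boolean combinations of `Formula.eval` (`bool3Set` / `bool3Cells`,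
  `measureReal_bool3Set_eq_linEval`), soundness `RowSpecS.holds` for EVERY placement `v`;
* `CertS` = the full vocabulary `{ts, kn, tc, nc, harris, vk, sh}` with THE WRAPPER `CertS.existsC_le_of_injective`.
-/

noncomputable section

namespace Summit.CriticalPhenomena.PercolationContinuityZ3.Theorems

open MeasureTheory Set Filter Literature.Probability.Percolation
open Literature.Probability.LatticeModels (prodBernoulli)
open scoped Classical BigOperators Topology
open PatternCells CertCheck ThresholdSunflower

namespace CertCells

variable {n : ℕ}

/-- All clauses of a DNF formula are positive (connection literals only). [folklore] -/
def posFormula (F : Formula) : Bool := F.all posClause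

/-- Strong-Harris threshold rows for three increasing events. [folklore] -/
inductive RowSpecS where
  /-- threshold one: `μ(O₁) μ(O₂ ∪ O₃) ≤ μ(A₂) μ(N)` -/
  | one (U₁ U₂ U₃ : Formula) (mult : List ℕ) (wt : ℕ)
  /-- threshold two: `μ(E₁₂) μ(E₁₃ ∪ E₂₃) ≤ μ(T) μ(L)` -/
  | two (U₁ U₂ U₃ : Formula) (mult : List ℕ) (wt : ℕ)
  deriving Repr

/-- Side conditions: the three formulas are positive. [folklore] -/
def RowSpecS.valid : RowSpecS → Bool
  | .one U₁ U₂ U₃ _ _ => posFormula U₁ && posFormula U₂ && posFormula U₃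
  | .two U₁ U₂ U₃ _ _ => posFormula U₁ && posFormula U₂ && posFormula U₃

/-- The event decided by a Boolean combination `g` of three formula events. [folklore] -/
def bool3Set (v : Fin 5 → Fin n) (U₁ U₂ U₃ : Formula) (g : Bool → Bool → Bool → Bool) : Set (BondConfig (Fin n)) :=
  {ω | g (decide (ω ∈ U₁.set v)) (decide (ω ∈ U₂.set v)) (decide (ω ∈ U₃.set v)) = true}

/-- Its cells. [folklore] -/
def bool3Cells (U₁ U₂ U₃ : Formula) (g : Bool → Bool → Bool → Bool) : List ℕ :=
  consPatterns.filter fun m => g (U₁.eval m) (U₂.eval m) (U₃.eval m)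

/-- `O₁`: only the first event. [folklore] -/
def gOnly1 : Bool → Bool → Bool → Bool := fun a b c => a && !b && !c
/-- `O₂ ∪ O₃`: only the second or only the third. [folklore] -/
def gOnly23 : Bool → Bool → Bool → Bool := fun a b c => (b && !a && !c) || (c && !a && !b)
/-- `A₂`: at least two. [folklore] -/
def gTwo : Bool → Bool → Bool → Bool := fun a b c => (a && b) || (a && c) || (b && c)
/-- `N`: none. [folklore] -/
def gNone : Bool → Bool → Bool → Bool := fun a b c => !a && !b && !c
/-- `E₁₂`: exactly the first two. [folklore] -/
def gEx12 : Bool → Bool → Bool → Bool := fun a b c => a && b && !c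
/-- `E₁₃ ∪ E₂₃`. [folklore] -/
def gEx13or23 : Bool → Bool → Bool → Bool := fun a b c => (a && c && !b) || (b && c && !a)
/-- `T`: all three. [folklore] -/
def gAll : Bool → Bool → Bool → Bool := fun a b c => a && b && c
/-- `L`: at most one. [folklore] -/
def gLeOne : Bool → Bool → Bool → Bool := fun a b c => !((a && b) || (a && c) || (b && c))

/-- Multiplier. [folklore] -/
def RowSpecS.mult : RowSpecS → List ℕ
  | .one _ _ _ m _ => m
  | .two _ _ _ m _ => m

/-- Weight. [folklore] -/
def RowSpecS.wt : RowSpecS → ℕ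
  | .one _ _ _ _ w => w
  | .two _ _ _ _ w => w

/-- The algebraic row. [folklore] -/
def RowSpecS.toRow : RowSpecS → Row
  | .one U₁ U₂ U₃ m w => ⟨bool3Cells U₁ U₂ U₃ gOnly1, bool3Cells U₁ U₂ U₃ gOnly23, bool3Cells U₁ U₂ U₃ gTwo,
      bool3Cells U₁ U₂ U₃ gNone, m, w⟩
  | .two U₁ U₂ U₃ m w => ⟨bool3Cells U₁ U₂ U₃ gEx12, bool3Cells U₁ U₂ U₃ gEx13or23, bool3Cells U₁ U₂ U₃ gAll,
      bool3Cells U₁ U₂ U₃ gLeOne, m, w⟩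

/-! ### Cell expansion of Boolean combinations -/

/-- **`μ(bool3Set) = linEval(bool3Cells)`** for every finite measure. [folklore] -/
theorem measureReal_bool3Set_eq_linEval (μ : Measure (BondConfig (Fin n))) [IsFiniteMeasure μ] (v : Fin 5 → Fin n)
    (U₁ U₂ U₃ : Formula) (g : Bool → Bool → Bool → Bool) :
    μ.real (bool3Set v U₁ U₂ U₃ g) = linEval (fun m => μ.real (Cell v m)) (bool3Cells U₁ U₂ U₃ g) := by
  rw [measureReal_eq_sum_cells μ v (bool3Set v U₁ U₂ U₃ g) (fun m => g (U₁.eval m) (U₂.eval m) (U₃.eval m)) ?_]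
  · exact sum_cells_eq_listSum _ _
  · intro m _ ω hω
    have h1 : decide (ω ∈ U₁.set v) = U₁.eval m := by
      by_cases h : ω ∈ U₁.set v
      · rw [decide_eq_true h, ((U₁.mem_set_iff v hω).1 h)]
      · rw [decide_eq_false h]; cases hU : U₁.eval m
        · rfl
        · exact absurd ((U₁.mem_set_iff v hω).2 hU) h
    have h2 : decide (ω ∈ U₂.set v) = U₂.eval m := by
      by_cases h : ω ∈ U₂.set v
      · rw [decide_eq_true h, ((U₂.mem_set_iff v hω).1 h)]
      · rw [decide_eq_false h]; cases hU : U₂.eval m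
        · rfl
        · exact absurd ((U₂.mem_set_iff v hω).2 hU) h
    have h3 : decide (ω ∈ U₃.set v) = U₃.eval m := by
      by_cases h : ω ∈ U₃.set v
      · rw [decide_eq_true h, ((U₃.mem_set_iff v hω).1 h)]
      · rw [decide_eq_false h]; cases hU : U₃.eval m
        · rfl
        · exact absurd ((U₃.mem_set_iff v hω).2 hU) h
    simp only [bool3Set, mem_setOf_eq, h1, h2, h3]

/-- A positive DNF formula denotes an increasing event. [folklore] -/
theorem isUpperSet_set_posFormula (v : Fin 5 → Fin n) {F : Formula} (hF : posFormula F = true) :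
    IsUpperSet (F.set v) := by
  intro ω ω' hle hω
  obtain ⟨cl, hcl, hall⟩ := hω
  have hpos : posClause cl = true := by
    unfold posFormula at hF
    exact List.all_eq_true.1 hF cl hcl
  have hmem : ω ∈ Formula.set v [cl] := (mem_set_single v cl ω).2 hall
  have hmem' := isUpperSet_set_posClause v hpos hle hmem
  exact ⟨cl, hcl, (mem_set_single v cl ω').1 hmem'⟩

/-! ### The Boolean events as set algebra -/

section SetAlgebra
variable (v : Fin 5 → Fin n) (U₁ U₂ U₃ : Formula)

/-- `O₁` as a set. [folklore] -/
theorem bool3Set_only1 : bool3Set v U₁ U₂ U₃ gOnly1 = U₁.set v ∩ (U₂.set v)ᶜ ∩ (U₃.set v)ᶜ := by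
  ext ω; simp only [bool3Set, gOnly1, mem_setOf_eq, mem_inter_iff, mem_compl_iff, Bool.and_eq_true, Bool.not_eq_true',
    decide_eq_true_eq, decide_eq_false_iff_not, and_assoc]

/-- `O₂` as a set. [folklore] -/
theorem bool3Set_only2 : bool3Set v U₁ U₂ U₃ (fun a b c => b && !a && !c) = U₂.set v ∩ (U₁.set v)ᶜ ∩ (U₃.set v)ᶜ := by
  ext ω; simp only [bool3Set, mem_setOf_eq, mem_inter_iff, mem_compl_iff, Bool.and_eq_true, Bool.not_eq_true',
    decide_eq_true_eq, decide_eq_false_iff_not, and_assoc]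

/-- `O₃` as a set. [folklore] -/
theorem bool3Set_only3 : bool3Set v U₁ U₂ U₃ (fun a b c => c && !a && !b) = U₃.set v ∩ (U₁.set v)ᶜ ∩ (U₂.set v)ᶜ := by
  ext ω; simp only [bool3Set, mem_setOf_eq, mem_inter_iff, mem_compl_iff, Bool.and_eq_true, Bool.not_eq_true',
    decide_eq_true_eq, decide_eq_false_iff_not, and_assoc]

/-- `O₂ ∪ O₃` as a union of the two Boolean events. [folklore] -/
theorem bool3Set_only23 : bool3Set v U₁ U₂ U₃ gOnly23 =
    bool3Set v U₁ U₂ U₃ (fun a b c => b && !a && !c) ∪ bool3Set v U₁ U₂ U₃ (fun a b c => c && !a && !b) := by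
  ext ω; simp only [bool3Set, gOnly23, mem_setOf_eq, mem_union, Bool.or_eq_true]

/-- `A₂` as a set. [folklore] -/
theorem bool3Set_two : bool3Set v U₁ U₂ U₃ gTwo =
    (U₁.set v ∩ U₂.set v) ∪ (U₁.set v ∩ U₃.set v) ∪ (U₂.set v ∩ U₃.set v) := by
  ext ω; simp only [bool3Set, gTwo, mem_setOf_eq, mem_union, mem_inter_iff, Bool.or_eq_true, Bool.and_eq_true,
    decide_eq_true_eq, or_assoc]

/-- `N` as a set. [folklore] -/
theorem bool3Set_none : bool3Set v U₁ U₂ U₃ gNone = (U₁.set v)ᶜ ∩ (U₂.set v)ᶜ ∩ (U₃.set v)ᶜ := by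
  ext ω; simp only [bool3Set, gNone, mem_setOf_eq, mem_inter_iff, mem_compl_iff, Bool.and_eq_true, Bool.not_eq_true',
    decide_eq_false_iff_not, and_assoc]

/-- `E₁₂` as a set. [folklore] -/
theorem bool3Set_ex12 : bool3Set v U₁ U₂ U₃ gEx12 = U₁.set v ∩ U₂.set v ∩ (U₃.set v)ᶜ := by
  ext ω; simp only [bool3Set, gEx12, mem_setOf_eq, mem_inter_iff, mem_compl_iff, Bool.and_eq_true, Bool.not_eq_true',
    decide_eq_true_eq, decide_eq_false_iff_not, and_assoc]

/-- `E₁₃` as a set. [folklore] -/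
theorem bool3Set_ex13 : bool3Set v U₁ U₂ U₃ (fun a b c => a && c && !b) = U₁.set v ∩ U₃.set v ∩ (U₂.set v)ᶜ := by
  ext ω; simp only [bool3Set, mem_setOf_eq, mem_inter_iff, mem_compl_iff, Bool.and_eq_true, Bool.not_eq_true',
    decide_eq_true_eq, decide_eq_false_iff_not, and_assoc]

/-- `E₂₃` as a set. [folklore] -/
theorem bool3Set_ex23 : bool3Set v U₁ U₂ U₃ (fun a b c => b && c && !a) = U₂.set v ∩ U₃.set v ∩ (U₁.set v)ᶜ := by
  ext ω; simp only [bool3Set, mem_setOf_eq, mem_inter_iff, mem_compl_iff, Bool.and_eq_true, Bool.not_eq_true',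
    decide_eq_true_eq, decide_eq_false_iff_not, and_assoc]

/-- `E₁₃ ∪ E₂₃` as a union of the two Boolean events. [folklore] -/
theorem bool3Set_ex13or23 : bool3Set v U₁ U₂ U₃ gEx13or23 =
    bool3Set v U₁ U₂ U₃ (fun a b c => a && c && !b) ∪ bool3Set v U₁ U₂ U₃ (fun a b c => b && c && !a) := by
  ext ω; simp only [bool3Set, gEx13or23, mem_setOf_eq, mem_union, Bool.or_eq_true]

/-- `T` as a set. [folklore] -/
theorem bool3Set_all : bool3Set v U₁ U₂ U₃ gAll = U₁.set v ∩ U₂.set v ∩ U₃.set v := by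
  ext ω; simp only [bool3Set, gAll, mem_setOf_eq, mem_inter_iff, Bool.and_eq_true, decide_eq_true_eq, and_assoc]

/-- `L` as a set. [folklore] -/
theorem bool3Set_leOne : bool3Set v U₁ U₂ U₃ gLeOne =
    ((U₁.set v ∩ U₂.set v) ∪ (U₁.set v ∩ U₃.set v) ∪ (U₂.set v ∩ U₃.set v))ᶜ := by
  ext ω
  simp only [bool3Set, gLeOne, mem_setOf_eq, mem_compl_iff, mem_union, mem_inter_iff, Bool.not_eq_true',
    Bool.or_eq_false_iff, Bool.and_eq_false_iff, decide_eq_false_iff_not, not_or, not_and_or]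

end SetAlgebra

/-- **Strong-Harris threshold row specs are valid rows**, for every weighted graph and every placement `v`.
[cite: Gladkov2024StrongFKG, Thm. 2.1] -/
theorem RowSpecS.holds (r : RowSpecS) (hr : r.valid = true) (w : Sym2 (Fin n) → unitInterval) (v : Fin 5 → Fin n) :
    linEval (fun m => (prodBernoulli w).real (Cell v m)) r.toRow.e1 *
        linEval (fun m => (prodBernoulli w).real (Cell v m)) r.toRow.e2 ≤
      linEval (fun m => (prodBernoulli w).real (Cell v m)) r.toRow.e3 *
        linEval (fun m => (prodBernoulli w).real (Cell v m)) r.toRow.e4 := by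
  have hmeas : ∀ s : Set (BondConfig (Fin n)), MeasurableSet s := fun _ => MeasurableSet.of_discrete
  cases r with
  | one U₁ U₂ U₃ mult wt =>
    unfold RowSpecS.valid at hr
    simp only [Bool.and_eq_true] at hr
    obtain ⟨⟨h1, h2⟩, h3⟩ := hr
    simp only [RowSpecS.toRow, ← measureReal_bool3Set_eq_linEval]
    set μ := prodBernoulli w with hμ
    have key := prodBernoulli_threshold_one_of_three w (isUpperSet_set_posFormula v h1) (isUpperSet_set_posFormula v h2)
      (isUpperSet_set_posFormula v h3)
    have hunion : μ.real (bool3Set v U₁ U₂ U₃ gOnly23) =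
        μ.real (U₂.set v ∩ (U₁.set v)ᶜ ∩ (U₃.set v)ᶜ) + μ.real (U₃.set v ∩ (U₁.set v)ᶜ ∩ (U₂.set v)ᶜ) := by
      rw [bool3Set_only23, ← bool3Set_only2 v U₁ U₂ U₃, ← bool3Set_only3 v U₁ U₂ U₃]
      refine measureReal_union ?_ (hmeas _)
      rw [bool3Set_only2, bool3Set_only3]
      exact Set.disjoint_left.2 fun ω hb hc => hc.2 hb.1.1
    rw [hunion, bool3Set_only1, bool3Set_two, bool3Set_none, mul_add]
    have hnn : 0 ≤ μ.real (U₂.set v ∩ (U₁.set v)ᶜ ∩ (U₃.set v)ᶜ) * μ.real (U₃.set v ∩ (U₁.set v)ᶜ ∩ (U₂.set v)ᶜ) :=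
      mul_nonneg measureReal_nonneg measureReal_nonneg
    linarith
  | two U₁ U₂ U₃ mult wt =>
    unfold RowSpecS.valid at hr
    simp only [Bool.and_eq_true] at hr
    obtain ⟨⟨h1, h2⟩, h3⟩ := hr
    simp only [RowSpecS.toRow, ← measureReal_bool3Set_eq_linEval]
    set μ := prodBernoulli w with hμ
    have key := prodBernoulli_threshold_two_of_three w (isUpperSet_set_posFormula v h1) (isUpperSet_set_posFormula v h2)
      (isUpperSet_set_posFormula v h3)
    have hunion : μ.real (bool3Set v U₁ U₂ U₃ gEx13or23) =
        μ.real (U₁.set v ∩ U₃.set v ∩ (U₂.set v)ᶜ) + μ.real (U₂.set v ∩ U₃.set v ∩ (U₁.set v)ᶜ) := by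
      rw [bool3Set_ex13or23, ← bool3Set_ex13 v U₁ U₂ U₃, ← bool3Set_ex23 v U₁ U₂ U₃]
      refine measureReal_union ?_ (hmeas _)
      rw [bool3Set_ex13, bool3Set_ex23]
      exact Set.disjoint_left.2 fun ω hb hc => hc.2 hb.1.1
    rw [hunion, bool3Set_ex12, bool3Set_all, bool3Set_leOne, mul_add]
    have hnn : 0 ≤ μ.real (U₁.set v ∩ U₃.set v ∩ (U₂.set v)ᶜ) * μ.real (U₂.set v ∩ U₃.set v ∩ (U₁.set v)ᶜ) :=
      mul_nonneg measureReal_nonneg measureReal_nonneg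
    linarith

/-- Permute a formula by a terminal permutation. [folklore] -/
def permFormula (σ : Fin 5 → Fin 5) (F : Formula) : Formula :=
  F.map fun cl => cl.map fun l => (σ l.1, σ l.2.1, l.2.2)

/-- Permute a threshold row spec (for folded certificates). [folklore] -/
def RowSpecS.permute (σ : Fin 5 → Fin 5) : RowSpecS → RowSpecS
  | .one U₁ U₂ U₃ m w => .one (permFormula σ U₁) (permFormula σ U₂) (permFormula σ U₃) (sortMono (m.map (permPattern σ))) w
  | .two U₁ U₂ U₃ m w => .two (permFormula σ U₁) (permFormula σ U₂) (permFormula σ U₃) (sortMono (m.map (permPattern σ))) w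

/-- Unfold threshold row specs under a list of terminal permutations. [folklore] -/
def unfoldRowsS (G : List (Fin 5 → Fin 5)) (rows : List RowSpecS) : List RowSpecS :=
  rows.flatMap fun r => G.map fun σ => r.permute σ

/-! ## Certificates over the vocabulary `{ts, kn, tc, nc, harris, vk, sh}` -/

/-- A certificate with all row families of parts 3, 7, 8, 9 and the threshold rows. [folklore] -/
structure CertS where
  /-- the target event -/
  L : Formula
  /-- the reference events -/
  U : List Formula
  /-- `ts`/`kn` rows -/
  rows : List RowSpec
  /-- `tc`/`nc` rows -/
  rowsX : List RowSpecX
  /-- Harris rows -/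
  rowsH : List RowSpecH
  /-- van den Berg–Kahn rows -/
  rowsV : List RowSpecV
  /-- strong-Harris threshold rows -/
  rowsS : List RowSpecS
  /-- multiplier terms -/
  al : List ATerm

/-- All rows satisfy their side conditions. [folklore] -/
def CertS.rowsValid (C : CertS) : Bool :=
  C.rows.all RowSpec.valid && C.rowsX.all RowSpecX.valid && C.rowsH.all RowSpecH.valid && C.rowsS.all RowSpecS.valid

/-- Cells of the reference event number `ref`. [folklore] -/
def CertS.Ucells (C : CertS) (ref : ℕ) : List ℕ := cellsOf (C.U.getD ref [])

/-- All algebraic rows. [folklore] -/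
def CertS.allRows (C : CertS) : List Row :=
  C.rows.map RowSpec.toRow ++ C.rowsX.map RowSpecX.toRow ++ C.rowsH.map RowSpecH.toRow ++ C.rowsV.map RowSpecV.toRow ++
    C.rowsS.map RowSpecS.toRow

/-- A multiplier term with positive weight on consistent cells. [folklore] -/
def CertS.posTerm (C : CertS) : Bool :=
  C.al.any fun a => decide (0 < a.wt) && a.mult.all fun c => decide (c ∈ consPatterns)

/-- The bucketed check with constant `p/q`. [folklore] -/
def CertS.checkCB (C : CertS) (p q nb b : ℕ) : Bool :=
  CertCheck.checkCB p q nb b (cellsOf C.L) C.Ucells C.allRows C.al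

/-- The fast bucketed check with constant `p/q`. [folklore] -/
def CertS.checkCBf (C : CertS) (p q nb b : ℕ) : Bool :=
  CertCheck.checkCBf p q nb b (cellsOf C.L) C.Ucells C.allRows C.al

/-- The fast check is the check. [folklore] -/
theorem CertS.checkCB_of_checkCBf (C : CertS) (p q nb : ℕ) (h : ∀ b < nb, C.checkCBf p q nb b = true) :
    ∀ b < nb, C.checkCB p q nb b = true := fun b hb => by
  unfold CertS.checkCB; rw [← CertCheck.checkCBf_eq]; exact h b hb

/-- All rows of a valid `CertS` hold at the cell law. [folklore] -/
theorem CertS.allRows_holds (C : CertS) (hvalid : C.rowsValid = true) (w : Sym2 (Fin n) → unitInterval)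
    (v : Fin 5 → Fin n) :
    ∀ r ∈ C.allRows, linEval (fun m => (prodBernoulli w).real (Cell v m)) r.e1 *
        linEval (fun m => (prodBernoulli w).real (Cell v m)) r.e2 ≤
      linEval (fun m => (prodBernoulli w).real (Cell v m)) r.e3 *
        linEval (fun m => (prodBernoulli w).real (Cell v m)) r.e4 := by
  unfold CertS.rowsValid at hvalid
  rw [Bool.and_eq_true, Bool.and_eq_true, Bool.and_eq_true, List.all_eq_true, List.all_eq_true, List.all_eq_true,
    List.all_eq_true] at hvalid
  obtain ⟨⟨⟨hR, hX⟩, hH⟩, hS⟩ := hvalid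
  intro r hr
  unfold CertS.allRows at hr
  rcases List.mem_append.1 hr with h | h
  · rcases List.mem_append.1 h with h' | h'
    · rcases List.mem_append.1 h' with h'' | h''
      · rcases List.mem_append.1 h'' with h3 | h3
        · obtain ⟨s, hs, rfl⟩ := List.mem_map.1 h3
          exact RowSpec.holds s (hR s hs) w v
        · obtain ⟨s, hs, rfl⟩ := List.mem_map.1 h3
          exact RowSpecX.holds s (hX s hs) w v
      · obtain ⟨s, hs, rfl⟩ := List.mem_map.1 h''
        exact RowSpecH.holds s (hH s hs) w v
    · obtain ⟨s, _, rfl⟩ := List.mem_map.1 h'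
      exact RowSpecV.holds s w v
  · obtain ⟨s, hs, rfl⟩ := List.mem_map.1 h
    exact RowSpecS.holds s (hS s hs) w v

/-- Measure-level soundness with constant, for `CertS`. [folklore] -/
theorem CertS.existsC_le (C : CertS) (hvalid : C.rowsValid = true) (p q : ℕ) {nb : ℕ} (hnb : 0 < nb)
    (hcheck : ∀ b < nb, C.checkCB p q nb b = true) (w : Sym2 (Fin n) → unitInterval) (v : Fin 5 → Fin n)
    (hpos : ∃ a ∈ C.al, 0 < (a.wt : ℝ) * evalM (fun m => (prodBernoulli w).real (Cell v m)) a.mult) :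
    ∃ a ∈ C.al, (q : ℝ) * (prodBernoulli w).real (C.L.set v) ≤
      (p : ℝ) * (prodBernoulli w).real ((C.U.getD a.ref []).set v) := by
  have hx : ∀ i, 0 ≤ (fun m => (prodBernoulli w).real (Cell v m)) i := fun _ => measureReal_nonneg
  have hs := soundC_of_buckets (fun m => (prodBernoulli w).real (Cell v m)) hx (cellsOf C.L) C.Ucells
    C.allRows C.al p q hnb (C.allRows_holds hvalid w v) hcheck
  have := existsC_le_of_sound (fun m => (prodBernoulli w).real (Cell v m)) hx (cellsOf C.L) C.Ucells C.al p q
    hs hpos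
  simpa [CertS.Ucells, measureReal_set_eq_linEval] using this

/-- **The certificate theorem with constant, vocabulary `{ts, kn, tc, nc, harris, vk, sh}`.**  Valid rows + all buckets +
a positive term ⇒ for every weighted graph and every injective placement of the five terminals, `q · μ(L) ≤ p · μ(U_{ref a})`
for some multiplier term `a`. [folklore] -/
theorem CertS.existsC_le_of_injective (C : CertS) (hvalid : C.rowsValid = true) (p q : ℕ) {nb : ℕ}
    (hnb : 0 < nb) (hcheck : ∀ b < nb, C.checkCB p q nb b = true) (hterm : C.posTerm = true)
    (w : Sym2 (Fin n) → unitInterval) {v : Fin 5 → Fin n} (hv : Function.Injective v) :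
    ∃ a ∈ C.al, (q : ℝ) * (prodBernoulli w).real (C.L.set v) ≤
      (p : ℝ) * (prodBernoulli w).real ((C.U.getD a.ref []).set v) := by
  obtain ⟨a₀, ha₀, hwa⟩ := List.any_eq_true.1 hterm
  rw [Bool.and_eq_true, decide_eq_true_eq, List.all_eq_true] at hwa
  obtain ⟨hwt, hmult⟩ := hwa
  have hk : ∀ k, ∃ a ∈ C.al, (q : ℝ) * (prodBernoulli (mixW w k)).real (C.L.set v) ≤
      (p : ℝ) * (prodBernoulli (mixW w k)).real ((C.U.getD a.ref []).set v) := by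
    intro k
    refine C.existsC_le hvalid p q hnb hcheck (mixW w k) v ⟨a₀, ha₀, mul_pos (by exact_mod_cast hwt) ?_⟩
    unfold evalM
    refine List.prod_pos fun y hy => ?_
    obtain ⟨c, hc, rfl⟩ := List.mem_map.1 hy
    have hc' : c ∈ consPatterns := by simpa using hmult c hc
    exact cell_pos (mixW w k) (fun e _ => mixW_pos_lt_one w k e) hv hc'
  by_contra hcon
  push Not at hcon
  have hev : ∀ a ∈ C.al.toFinset, ∀ᶠ k in atTop,
      (p : ℝ) * (prodBernoulli (mixW w k)).real ((C.U.getD a.ref []).set v) <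
        (q : ℝ) * (prodBernoulli (mixW w k)).real (C.L.set v) := by
    intro a ha
    exact ((((stub_weightContinuity n _).tendsto w).comp (tendsto_mixW w)).const_mul (p : ℝ)).eventually_lt
      ((((stub_weightContinuity n _).tendsto w).comp (tendsto_mixW w)).const_mul (q : ℝ))
      (hcon a (List.mem_toFinset.1 ha))
  obtain ⟨k, hk'⟩ := ((Finset.eventually_all _).2 hev).exists
  obtain ⟨a, ha, hle⟩ := hk k
  exact absurd hle (not_le.2 (hk' a (List.mem_toFinset.2 ha)))

end CertCells

end Summit.CriticalPhenomena.PercolationContinuityZ3.Theorems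

end
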